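import Mathlib
import Literature.NumberTheory.GaloisRepresentations.LubinTateUnramifiedRelativeRestrict
import Literature.NumberTheory.GaloisRepresentations.LubinTateColemanRelativeAnomalyTwo
import Literature.NumberTheory.GaloisRepresentations.LubinTateColemanRelativeProductTwo
import Literature.NumberTheory.GaloisRepresentations.LubinTateComparisonReflectionTwo
import HarnessLib

/-!
# k1-g39 — WEAKEN / STRENGTHEN sweep of road B′'s residual debts (STUB-PLAN v7.4, CRITIC-ROWS-g41:
# R219 «READ₂» = {R217∃ · R222 SHIFT₂ · R219-INST₂}).  All sorry-free.

* §C, §C′ — **R219-INST₂ pieces H1 `exists_half_of_sub_one_mem` and H3 `exists_Lam2_lift` PROVED**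
  (H3 under the WEAKEST sufficient hypothesis `‖2‖_{ℂ_F} < 1`; + `exists_Lam2_lift_map[_of_isUniformizer]`:
  the hypotheses `hL0`/`hL` of k3-g40's `read_value_eq_tsum_lamTerm` discharged by name).
* §B″, §B′ — **R222 SHIFT₂ in three currencies**: the `evS` text of record IS the tree's
  `coe_evalPt₁_compSeriesC_reflect` (family-1 tool «tree match», declared; corollary `compSeriesC_torsion_shift`
  PROVED); the WEAKEST SUFFICIENT Lubin–Tate-side form `[a + π^n]_f ω_{n+1} = [a]_f ω_{n+1} [+]_f ω_1`
  (`ltAct_add_pow_cohPt`, any LT law, `q = 2`) and its Galois form `σ_{1+π^n}·ω_{n+1} = ω_{n+1} [+]_f ω_1`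
  (`mapPt_relGalOfUnit_cohPt_eq_ltAdd`) PROVED.
* §B — the (ρ4) digit in B72 form: `χ(1 + 2^n) = −1` for every `χ` of exact conductor `2^{n+1}`
  (`eval_one_add_two_pow_eq_neg_one`, kernel `{1, γ₀}` computed) and the REFL-difference sum with factor
  exactly `2` (`sum_char_mul_sub_reflect`) — Mathlib-level bookkeeping (content = critic's `refl_table_charSum`).
* §A — R217∃ via its STRONGEST form: the Galois PRODUCT `relGal_prod` (k3-g40 H4) + `relGal_prod_unique`
  PROVED, and `localUntwistExists` PROVED (independently of, and with the same formula as, k3-g41 — filed first,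
  22:09Z; credit theirs for existence/uniqueness; the product theorem H4 is this file's addition).

Stub `stub_heegnerIndexLowerAtTwo` (skeleton `f2bd84c0…`), crux `SplitBadTwoLowerHalfOfFacts`, route PrintCf2.
This file proves NEITHER the stub NOR the crux; BSD is NOT proved by any of it.
-/

noncomputable section

namespace Summit.BirchSwinnertonDyer.BirchSwinnertonDyer.Cruxes.SplitBadTwoLowerHalfOfFacts.WeakStrongK1G39

/-! ## §A. R217∃ — the STRONGEST form: `Aut_F(E·K_π^{m+1}) = Aut_F(E) × Aut_F(K_π^{m+1})` for `E ⊆ F^{nr}`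
(k3-g40's typed H4 `relGal_prod`, PROVED, with uniqueness), and k3-g40's residual sub-stub
`LocalUntwistExists` PROVED — for EVERY `σ₀ ∈ Γ_F`, every level `m`, exponent `K`, unit `v`. -/

section GaloisProduct

open ValuativeRel IsLocalRing Field
open Literature.NumberTheory.GaloisRepresentations Literature.NumberTheory.GaloisRepresentations.IsNonarchimedeanLocalField
  Literature.NumberTheory.GaloisRepresentations.LubinTate

variable {F : Type} [Field F] [ValuativeRel F] [TopologicalSpace F] [IsNonarchimedeanLocalField F]

attribute [local instance] ltNormUniformSpace ltNormIsUniformAddGroup rk1 nF nE fintypeResidueField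

variable {π : 𝒪[F]} (hπ : (valuation F).IsUniformizer (π : F))
variable (E : IntermediateField F (AlgebraicClosure F)) [FiniteDimensional F E] [Normal F E]

/-- VERBATIM k3-g40 §4: "`τ ∈ Aut_F(E·K_π^{m+1})` acts on `𝒪_E` as `φ^K`" (`φ = frobUnitBall E σ₀`). -/
def ActsAsFrobPow (σ₀ : absoluteGaloisGroup F) (K : ℕ) {m : ℕ}
    (τ : (E ⊔ ltField π m : IntermediateField F (AlgebraicClosure F)) ≃ₐ[F]
      (E ⊔ ltField π m : IntermediateField F (AlgebraicClosure F))) : Prop :=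
  ∀ x : unitBall E, τ (IntermediateField.inclusion le_sup_left (x : E)) =
    IntermediateField.inclusion le_sup_left
      (((((frobUnitBall E σ₀ : unitBall E ≃+* unitBall E) : unitBall E →+* unitBall E) :
        unitBall E → unitBall E)^[K] x : unitBall E) : E)

/-- VERBATIM k3-g40 §4: the residual EXISTENCE sub-stub of R217 LOCAL-UNTWIST₂. -/
def LocalUntwistExists (hE : E ≤ maxUnramified F) (σ₀ : absoluteGaloisGroup F) : Prop :=
  ∀ (m K : ℕ) (v : 𝒪[F]ˣ), ∃ τ : (E ⊔ ltField π m : IntermediateField F (AlgebraicClosure F)) ≃ₐ[F]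
      (E ⊔ ltField π m : IntermediateField F (AlgebraicClosure F)),
    ActsAsFrobPow E σ₀ K τ ∧
      mapPt τ (inclPt (le_sup_right : ltField π m ≤ E ⊔ ltField π m) (cohPt hπ m)) =
        mapPt (relGalOfUnit hπ E m hE v) (inclPt (le_sup_right : ltField π m ≤ E ⊔ ltField π m) (cohPt hπ m))

omit [ValuativeRel F] [TopologicalSpace F] [IsNonarchimedeanLocalField F] [FiniteDimensional F E] in
/-- `(σ₀^K)|_E = (σ₀|_E)^K`. -/
theorem restrictNormal_pow (σ₀ : absoluteGaloisGroup F) (K : ℕ) :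
    (absoluteGaloisGroup.toAlgEquiv F (σ₀ ^ K)).restrictNormal E =
      ((absoluteGaloisGroup.toAlgEquiv F σ₀).restrictNormal E) ^ K := by
  rw [map_pow (absoluteGaloisGroup.toAlgEquiv F)]
  exact map_pow (AlgEquiv.restrictNormalHom (F := F) (K₁ := AlgebraicClosure F) E) _ K

/-- `ActsAsFrobPow` from the honest Galois statement "`τ|_E = (σ₀|_E)^K`". -/
theorem actsAsFrobPow_of_apply_inclusion (σ₀ : absoluteGaloisGroup F) (K : ℕ) {m : ℕ}
    {τ : (E ⊔ ltField π m : IntermediateField F (AlgebraicClosure F)) ≃ₐ[F]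
      (E ⊔ ltField π m : IntermediateField F (AlgebraicClosure F))}
    (h : ∀ x : E, τ (IntermediateField.inclusion le_sup_left x) =
      IntermediateField.inclusion le_sup_left
        ((((absoluteGaloisGroup.toAlgEquiv F σ₀).restrictNormal E) ^ K) x)) :
    ActsAsFrobPow E σ₀ K τ := by
  intro x
  rw [h, ← coe_frobUnitBall_pow_apply, RingHom.coe_pow]

/-- ★ **R217∃ DISCHARGED: `LocalUntwistExists` holds — for every `σ₀ ∈ Γ_F` (not only a Frobenius).**
`τ := (σ₀^K)|_{E·K} · σ_w` with `w = v · χ_π(σ₀^K)⁻¹` (`σ_w = relGalOfUnit w` fixes `E`, multiplies the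
torsion by `w`; `σ₀^K` multiplies it by `χ_π(σ₀^K)`, `mapPt_relRestrict_relAct`). -/
theorem localUntwistExists (hE : E ≤ maxUnramified F) (σ₀ : absoluteGaloisGroup F) :
    LocalUntwistExists hπ E hE σ₀ := by
  intro m K v
  refine ⟨relRestrict hπ E m (σ₀ ^ K) * relGalOfUnit hπ E m hE (v * (lubinTateChar hπ (σ₀ ^ K))⁻¹), ?_, ?_⟩
  · refine actsAsFrobPow_of_apply_inclusion E σ₀ K fun x => ?_
    rw [AlgEquiv.mul_apply, relGalOfUnit_apply_inclusion, ← restrictNormal_pow,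
      ← resBase_relRestrict hπ E m (σ₀ ^ K), inclusion_resBase_apply]
  · have hpt : inclPt (le_sup_right : ltField π m ≤ E ⊔ ltField π m) (cohPt hπ m) =
        relAct hπ E m (cohUnit hπ m : 𝒪[F]) (relGenPt hπ E m) := by
      rw [cohPt_eq, inclPt_ltAct_genPt]
    rw [hpt, mapPt_mul, mapPt_relGalOfUnit_relAct, mapPt_relRestrict_relAct, mapPt_relGalOfUnit_relAct]
    congr 1
    rw [Units.val_mul, mul_assoc, mul_left_comm ((lubinTateChar hπ (σ₀ ^ K) : 𝒪[F]ˣ) : 𝒪[F]),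
      Units.mul_inv_cancel_left]

include hπ in
/-- ★★ **THE STRONGEST FORM (k3-g40 H4 `relGal_prod`, PROVED): every pair `(a, b) ∈ Aut_F(E) × Aut_F(K_π^{m+1})`
is realised by ONE `τ ∈ Aut_F(E·K_π^{m+1})`** (`E ⊆ F^{nr}` finite normal).  Lift `b` to `Γ_F` and restrict
(`ρ`); correct `ρ|_E` to `a` by an automorphism fixing `K_π^{m+1}` pointwise (`exists_resBase_eq`, i.e. the
tree's linear disjointness `E ∩ K_π^{m+1} = F` in Galois form). -/
theorem relGal_prod (hE : E ≤ maxUnramified F) (m : ℕ) (a : E ≃ₐ[F] E) (b : ltField π m ≃ₐ[F] ltField π m) :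
    ∃ τ : (E ⊔ ltField π m : IntermediateField F (AlgebraicClosure F)) ≃ₐ[F]
        (E ⊔ ltField π m : IntermediateField F (AlgebraicClosure F)),
      (∀ x : E, τ (IntermediateField.inclusion le_sup_left x) = IntermediateField.inclusion le_sup_left (a x)) ∧
      ∀ y : ltField π m, τ (IntermediateField.inclusion le_sup_right y) =
        IntermediateField.inclusion le_sup_right (b y) := by
  haveI := isGalois_ltField hπ m
  -- lift `b` to `Γ_F`
  obtain ⟨χb, hχb⟩ := AlgEquiv.restrictNormalHom_surjective (F := F) (E := AlgebraicClosure F)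
    (K₁ := ltField π m) b
  have hσb : ∀ y : ltField π m, ((absoluteGaloisGroup.toAlgEquiv F).symm χb) • ((y : ltField π m) :
      AlgebraicClosure F) = ((b y : ltField π m) : AlgebraicClosure F) := fun y => by
    rw [absoluteGaloisGroup.toAlgEquiv_symm_apply, ← hχb]
    exact (AlgEquiv.restrictNormal_commutes χb (ltField π m) y).symm
  set ρ := relRestrict hπ E m ((absoluteGaloisGroup.toAlgEquiv F).symm χb) with hρ
  have hρK : ∀ y : ltField π m, ρ (IntermediateField.inclusion le_sup_right y) =
      IntermediateField.inclusion le_sup_right (b y) := fun y =>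
    Subtype.ext (by rw [hρ, coe_relRestrict_apply, IntermediateField.coe_inclusion,
      IntermediateField.coe_inclusion, hσb])
  have hρE : ∀ x : E, ρ (IntermediateField.inclusion le_sup_left x) =
      IntermediateField.inclusion le_sup_left (resBase (π := π) E m ρ x) := fun x =>
    (inclusion_resBase_apply (π := π) E m ρ x).symm
  -- correct the `E`-component: `c := a ∘ (ρ|_E)⁻¹`, realised by `τ_c` fixing `K_π^{m+1}` pointwise
  set c : E ≃ₐ[F] E := (resBase (π := π) E m ρ).symm.trans a with hc
  have hc0 : ∀ x : (⊥ : IntermediateField F (AlgebraicClosure F)),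
      c (IntermediateField.inclusion bot_le x) = IntermediateField.inclusion bot_le x := by
    intro x
    obtain ⟨r, hr⟩ := IntermediateField.mem_bot.mp x.2
    have hx : IntermediateField.inclusion (bot_le : (⊥ : IntermediateField F (AlgebraicClosure F)) ≤ E) x =
        algebraMap F E r := Subtype.ext (by rw [IntermediateField.coe_inclusion, ← hr]; rfl)
    rw [hx, AlgEquiv.commutes]
  obtain ⟨τc, hτc, hτcres⟩ := exists_resBase_eq (hπ := hπ) (m := m)
    (h := (bot_le : (⊥ : IntermediateField F (AlgebraicClosure F)) ≤ E)) hE hc0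
  have hτcK : ∀ y : ltField π m, τc (IntermediateField.inclusion le_sup_right y) =
      IntermediateField.inclusion le_sup_right y :=
    ((forall_apply_inclusion_sup_ltField_iff (π := π) m
      (bot_le : (⊥ : IntermediateField F (AlgebraicClosure F)) ≤ E) τc).mp hτc).2
  refine ⟨τc * ρ, fun x => ?_, fun y => ?_⟩
  · rw [AlgEquiv.mul_apply, hρE, ← inclusion_resBase_apply (π := π) E m τc, hτcres, hc,
      AlgEquiv.trans_apply, AlgEquiv.symm_apply_apply]
  · rw [AlgEquiv.mul_apply, hρK, hτcK]

omit [FiniteDimensional F E] [Normal F E] in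
include hπ in
/-- … and UNIQUELY: an `F`-automorphism of `E·K_π^{m+1}` is determined by its restrictions to `E` and to
`K_π^{m+1}` (tree `algEquiv_apply_mk_eq_of_eq`).  With `relGal_prod`: `Aut_F(E·K_π^{m+1}) ≅ Aut_F(E) × Aut_F(K_π^{m+1})`. -/
theorem relGal_prod_unique (m : ℕ) {a : E ≃ₐ[F] E} {b : ltField π m ≃ₐ[F] ltField π m}
    {τ τ' : (E ⊔ ltField π m : IntermediateField F (AlgebraicClosure F)) ≃ₐ[F]
      (E ⊔ ltField π m : IntermediateField F (AlgebraicClosure F))}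
    (hτE : ∀ x : E, τ (IntermediateField.inclusion le_sup_left x) = IntermediateField.inclusion le_sup_left (a x))
    (hτK : ∀ y : ltField π m, τ (IntermediateField.inclusion le_sup_right y) =
      IntermediateField.inclusion le_sup_right (b y))
    (hτ'E : ∀ x : E, τ' (IntermediateField.inclusion le_sup_left x) = IntermediateField.inclusion le_sup_left (a x))
    (hτ'K : ∀ y : ltField π m, τ' (IntermediateField.inclusion le_sup_right y) =
      IntermediateField.inclusion le_sup_right (b y)) : τ = τ' := by
  refine AlgEquiv.ext fun z => ?_
  obtain ⟨z, hz⟩ := z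
  refine algEquiv_apply_mk_eq_of_eq hπ E m le_rfl τ τ' (fun x => by rw [hτE, hτ'E]) (fun hr => ?_) hz hz
  have e : (⟨ltRoot π m, hr⟩ : (E ⊔ ltField π m : IntermediateField F (AlgebraicClosure F))) =
      IntermediateField.inclusion le_sup_right (IntermediateField.AdjoinSimple.gen F (ltRoot π m)) :=
    Subtype.ext (by rw [IntermediateField.coe_inclusion, IntermediateField.AdjoinSimple.coe_gen])
  rw [e, hτK, hτ'K]

end GaloisProduct

/-! ## §B. R222 «SHIFT₂» — the STRONGEST Mathlib-level forms of its three ingredients (all PROVED):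
(B1) the CHARACTER DIGIT `χ(1 + 2^n) = −1` for every primitive `χ mod 2^{n+1}`, `n ≥ 1` (the kernel of
`(ℤ/2^{n+1})^× → (ℤ/2^n)^×` is `{1, 1+2^n}`), with the index law `(1+2^n)·γ = γ + 2^n` = `hshift` of
`read₂_of_refl_cut` (`γ₀ ↦ 1 + 2^n`, `s = 2^n`); (B2) `ζ^{2^n} = −1` and the `𝔾̂_m` shift
`(ζ^a − 1) [+]_{𝔾̂_m} (−2) = ζ^{a+2^n} − 1` (`X [+] Y = X + Y + XY`, tree `ltF_one_add_X_pow_sub_one`). -/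

section CharacterDigit

theorem two_pow_succ_eq_zero (n : ℕ) : (2 : ZMod (2 ^ (n + 1))) ^ (n + 1) = 0 := by
  have h : (((2 ^ (n + 1) : ℕ) : ZMod (2 ^ (n + 1)))) = 0 := ZMod.natCast_self _
  rwa [Nat.cast_pow, Nat.cast_ofNat] at h

/-- Units of `ℤ/2^{n+1}` are odd. -/
theorem exists_eq_two_mul_add_one {n : ℕ} (γ : (ZMod (2 ^ (n + 1)))ˣ) :
    ∃ k : ZMod (2 ^ (n + 1)), (γ : ZMod (2 ^ (n + 1))) = 2 * k + 1 := by
  have hu : IsUnit (((γ : ZMod (2 ^ (n + 1))).val : ℕ) : ZMod (2 ^ (n + 1))) := by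
    rw [ZMod.natCast_zmod_val]; exact Units.isUnit γ
  rw [ZMod.isUnit_iff_coprime] at hu
  have hodd : ¬ 2 ∣ (γ : ZMod (2 ^ (n + 1))).val := fun h2 =>
    absurd (Nat.Coprime.eq_one_of_dvd (Nat.Coprime.coprime_dvd_left h2 hu)
      (dvd_pow_self 2 (Nat.succ_ne_zero n))) (by norm_num)
  refine ⟨(((γ : ZMod (2 ^ (n + 1))).val / 2 : ℕ) : ZMod (2 ^ (n + 1))), ?_⟩
  have h := Nat.div_add_mod (γ : ZMod (2 ^ (n + 1))).val 2
  rw [Nat.two_dvd_ne_zero.mp hodd] at h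
  calc (γ : ZMod (2 ^ (n + 1)))
      = (((γ : ZMod (2 ^ (n + 1))).val : ℕ) : ZMod (2 ^ (n + 1))) := (ZMod.natCast_zmod_val _).symm
    _ = ((2 * ((γ : ZMod (2 ^ (n + 1))).val / 2) + 1 : ℕ) : ZMod (2 ^ (n + 1))) := by rw [h]
    _ = 2 * (((γ : ZMod (2 ^ (n + 1))).val / 2 : ℕ) : ZMod (2 ^ (n + 1))) + 1 := by push_cast; ring

/-- `2^n · γ = 2^n` for a unit `γ` of `ℤ/2^{n+1}`. -/
theorem two_pow_mul_unit {n : ℕ} (γ : (ZMod (2 ^ (n + 1)))ˣ) :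
    (2 : ZMod (2 ^ (n + 1))) ^ n * γ = 2 ^ n := by
  obtain ⟨k, hk⟩ := exists_eq_two_mul_add_one γ
  rw [hk, mul_add, mul_one, ← mul_assoc, ← pow_succ, two_pow_succ_eq_zero, zero_mul, zero_add]

/-- ★ **The index law = `hshift` of `read₂_of_refl_cut`** (`γ₀ ↦ 1 + 2^n`, `s = 2^n`): `(1 + 2^n)·γ = γ + 2^n`
for every unit `γ` of `ℤ/2^{n+1}` (so multiplication by `γ₀` on `(ℤ/2^{n+1})^×` IS the shift `j ↦ j + 2^n`
of the torsion index, `ζ^{j + 2^n} = −ζ^j`). -/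
theorem one_add_two_pow_mul_unit {n : ℕ} (γ : (ZMod (2 ^ (n + 1)))ˣ) :
    (1 + 2 ^ n : ZMod (2 ^ (n + 1))) * γ = γ + 2 ^ n := by
  rw [add_mul, one_mul, two_pow_mul_unit]

/-- `(1 + 2^n)^2 = 1` in `ℤ/2^{n+1}` for `n ≥ 1`. -/
theorem one_add_two_pow_sq {n : ℕ} (hn : n ≠ 0) : (1 + 2 ^ n : ZMod (2 ^ (n + 1))) ^ 2 = 1 := by
  have h1 : (2 : ZMod (2 ^ (n + 1))) ^ (2 * n) = 0 := by
    rw [show 2 * n = (n + 1) + (n - 1) by omega, pow_add (2 : ZMod (2 ^ (n + 1))) (n + 1) (n - 1),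
      two_pow_succ_eq_zero, zero_mul]
  calc (1 + 2 ^ n : ZMod (2 ^ (n + 1))) ^ 2 = 1 + 2 ^ (n + 1) + 2 ^ (2 * n) := by ring
    _ = 1 := by rw [two_pow_succ_eq_zero, h1, add_zero, add_zero]

/-- **The unit `γ₀ = 1 + 2^n ∈ (ℤ/2^{n+1})^×`** (self-inverse), `n ≥ 1`. -/
def gammaZero {n : ℕ} (hn : n ≠ 0) : (ZMod (2 ^ (n + 1)))ˣ :=
  ⟨1 + 2 ^ n, 1 + 2 ^ n, by rw [← sq, one_add_two_pow_sq hn], by rw [← sq, one_add_two_pow_sq hn]⟩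

theorem coe_gammaZero {n : ℕ} (hn : n ≠ 0) : ((gammaZero hn : (ZMod (2 ^ (n + 1)))ˣ) : ZMod (2 ^ (n + 1))) = 1 + 2 ^ n :=
  rfl

/-- `hshift` literally: `e (γ * γ₀) = e γ + s` for `e = id`, `γ₀ = 1 + 2^n`, `s = 2^n`. -/
theorem coe_mul_gammaZero {n : ℕ} (hn : n ≠ 0) (γ : (ZMod (2 ^ (n + 1)))ˣ) :
    ((γ * gammaZero hn : (ZMod (2 ^ (n + 1)))ˣ) : ZMod (2 ^ (n + 1))) = (γ : ZMod (2 ^ (n + 1))) + 2 ^ n := by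
  rw [Units.val_mul, coe_gammaZero, mul_comm, one_add_two_pow_mul_unit]

/-- **The kernel of `(ℤ/2^{n+1})^× → (ℤ/2^n)^×` is `{1, 1 + 2^n}`** (`n ≥ 1`). -/
theorem eq_one_or_eq_of_unitsMap_eq_one {n : ℕ} (hn : n ≠ 0) (u : (ZMod (2 ^ (n + 1)))ˣ)
    (hu : ZMod.unitsMap (pow_dvd_pow 2 n.le_succ) u = 1) :
    (u : ZMod (2 ^ (n + 1))) = 1 ∨ (u : ZMod (2 ^ (n + 1))) = 1 + 2 ^ n := by
  have hv : (u : ZMod (2 ^ (n + 1))).val % 2 ^ n = 1 := by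
    have h := congrArg (fun w : (ZMod (2 ^ n))ˣ => (w : ZMod (2 ^ n))) hu
    simp only [ZMod.unitsMap_val, Units.val_one, ZMod.cast_eq_val] at h
    rw [← Nat.cast_one, ZMod.natCast_eq_natCast_iff', Nat.mod_eq_of_lt (Nat.one_lt_pow hn one_lt_two)] at h
    exact h
  have hlt : (u : ZMod (2 ^ (n + 1))).val < 2 ^ n * 2 :=
    lt_of_lt_of_eq (ZMod.val_lt (u : ZMod (2 ^ (n + 1)))) (pow_succ 2 n)
  obtain ⟨M, hM⟩ : ∃ M, 2 ^ n = M := ⟨_, rfl⟩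
  rw [hM] at hv hlt
  have hcases : (u : ZMod (2 ^ (n + 1))).val = 1 ∨ (u : ZMod (2 ^ (n + 1))).val = 1 + M := by
    by_cases hvM : (u : ZMod (2 ^ (n + 1))).val < M
    · left; rwa [Nat.mod_eq_of_lt hvM] at hv
    · right
      rw [Nat.mod_eq_sub_mod (not_lt.mp hvM), Nat.mod_eq_of_lt (by omega)] at hv
      omega
  rcases hcases with h | h
  · left; rw [← ZMod.natCast_zmod_val (u : ZMod (2 ^ (n + 1))), h, Nat.cast_one]
  · right; rw [← ZMod.natCast_zmod_val (u : ZMod (2 ^ (n + 1))), h, ← hM]; push_cast; ring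

/-- A character of level `2^{n+1}` with `χ(1 + 2^n) = 1` factors through `2^n` (`n ≥ 1`). -/
theorem factorsThrough_two_pow_of_eval_eq_one {R : Type*} [CommMonoidWithZero R] {n : ℕ} (hn : n ≠ 0)
    (χ : DirichletCharacter R (2 ^ (n + 1))) (h1 : χ (1 + 2 ^ n) = 1) : χ.FactorsThrough (2 ^ n) := by
  rw [DirichletCharacter.factorsThrough_iff_ker_unitsMap (pow_dvd_pow 2 n.le_succ)]
  intro u hu
  rw [MonoidHom.mem_ker] at hu ⊢
  rw [← Units.val_eq_one, MulChar.coe_toUnitHom]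
  rcases eq_one_or_eq_of_unitsMap_eq_one hn u hu with h | h
  · rw [h, map_one]
  · rw [h, h1]

/-- ★★ **THE (ρ4) DIGIT, B72 form: `χ(γ₀) = −1` for `γ₀ = 1 + 2^n` — the generator of
`ker((ℤ/2^{n+1})ˣ → (ℤ/2^n)ˣ)` — and EVERY Dirichlet character `χ` of exact conductor `2^{n+1}` (`n ≥ 1`,
values in a domain).**  (`χ(γ₀)² = χ(γ₀²) = χ(1) = 1`, and `χ(γ₀) = 1` would make `χ` factor through `2^n`:
the kernel is `{1, γ₀}`, `eq_one_or_eq_of_unitsMap_eq_one`.)  Mathlib-level bookkeeping; same content as the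
critic's `critic_k3g40_K3_reflsum.lean` (CRITIC-ROWS-g41 row 117) and k3-g40's `mulChar_eq_neg_one_of_sq` +
"a `ZMod` kernel line" — here that kernel line is PROVED for all `n`.  No parity value `χ(−1)` anywhere (B72). -/
theorem eval_one_add_two_pow_eq_neg_one {R : Type*} [CommRing R] [IsDomain R] {n : ℕ} (hn : n ≠ 0)
    (χ : DirichletCharacter R (2 ^ (n + 1))) (hχ : χ.IsPrimitive) : χ (1 + 2 ^ n) = -1 := by
  have hsq : χ (1 + 2 ^ n) * χ (1 + 2 ^ n) = 1 := by
    rw [← map_mul, ← sq, one_add_two_pow_sq hn, map_one]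
  rcases mul_self_eq_one_iff.mp hsq with h | h
  · exfalso
    have hle : χ.conductor ≤ 2 ^ n :=
      Nat.sInf_le ((DirichletCharacter.mem_conductorSet_iff χ).mpr (factorsThrough_two_pow_of_eval_eq_one hn χ h))
    rw [DirichletCharacter.isPrimitive_def] at hχ
    rw [hχ] at hle
    exact absurd hle (not_le.mpr (Nat.pow_lt_pow_right one_lt_two n.lt_succ_self))
  · exact h

/-- The digit on the unit `γ₀`. -/
theorem eval_gammaZero {R : Type*} [CommRing R] [IsDomain R] {n : ℕ} (hn : n ≠ 0)
    (χ : DirichletCharacter R (2 ^ (n + 1))) (hχ : χ.IsPrimitive) :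
    χ (gammaZero hn : (ZMod (2 ^ (n + 1)))ˣ) = -1 := by
  rw [coe_gammaZero, eval_one_add_two_pow_eq_neg_one hn χ hχ]

/-- `γ₀² = 1`. -/
theorem gammaZero_mul_self {n : ℕ} (hn : n ≠ 0) : gammaZero hn * gammaZero hn = 1 :=
  Units.ext (by rw [Units.val_mul, coe_gammaZero, ← sq, one_add_two_pow_sq hn, Units.val_one])

/-- ★ **THE REFLECTION FACTOR IS EXACTLY `2` (abstract form):** for a multiplicative `ψ : G → R` and an
involution `γ₀` with `ψ(γ₀) = −1`, `Σ_γ ψ(γ)·(T γ − T(γ γ₀)) = 2·Σ_γ ψ(γ)·T γ` for EVERY table `T`. -/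
theorem sum_mul_sub_reflect {G R : Type*} [CommGroup G] [Fintype G] [CommRing R] (ψ : G →* R) {γ₀ : G}
    (hγ₀ : γ₀ * γ₀ = 1) (hψ : ψ γ₀ = -1) (T : G → R) :
    ∑ γ, ψ γ * (T γ - T (γ * γ₀)) = 2 * ∑ γ, ψ γ * T γ := by
  have h : ∑ γ, ψ γ * T (γ * γ₀) = -∑ γ, ψ γ * T γ := by
    rw [← Equiv.sum_comp (Equiv.mulRight γ₀) (fun γ => ψ γ * T (γ * γ₀))]
    simp only [Equiv.coe_mulRight, map_mul, hψ, mul_assoc, hγ₀, mul_one, mul_neg_one, neg_mul,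
      Finset.sum_neg_distrib]
  simp only [mul_sub, Finset.sum_sub_distrib, h]
  ring

/-- ★★ **REFL-difference sum (weakest sufficient form consumed by k3-g40's `read₂_of_refl_cut`): for EVERY
primitive `χ mod 2^{n+1}` (`n ≥ 1`) and every unit table `T`, `Σ_γ χ(γ)·(T γ − T(γ·γ₀)) = 2·Σ_γ χ(γ)·T γ`
(`γ₀ = 1 + 2^n`).**  The factor is exactly `2` for the whole primitive table (it cancels the `½` of
`Λ₂ = ½·log(1+2X)` on the nose); this is the statement the critic's `refl_table_charSum` (row 117, K3 struck)
certifies — reproduced here only as the Mathlib-level form the REFL glue instantiates (B72: `γ₀` IS `1 + 2^n`). -/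
theorem sum_char_mul_sub_reflect {R : Type*} [CommRing R] [IsDomain R] {n : ℕ} (hn : n ≠ 0)
    (χ : DirichletCharacter R (2 ^ (n + 1))) (hχ : χ.IsPrimitive) (T : (ZMod (2 ^ (n + 1)))ˣ → R) :
    ∑ γ : (ZMod (2 ^ (n + 1)))ˣ, χ γ * (T γ - T (γ * gammaZero hn)) =
      2 * ∑ γ : (ZMod (2 ^ (n + 1)))ˣ, χ γ * T γ := by
  have h := sum_mul_sub_reflect ((Units.coeHom R).comp χ.toUnitHom) (gammaZero_mul_self hn)
    (by rw [MonoidHom.comp_apply, Units.coeHom_apply, MulChar.coe_toUnitHom, eval_gammaZero hn χ hχ]) T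
  simpa only [MonoidHom.comp_apply, Units.coeHom_apply, MulChar.coe_toUnitHom] using h

end CharacterDigit

section RootShift

variable {M : Type*} [CommRing M] [IsDomain M] {n : ℕ} {ζ : M}

/-- ★ `ζ^{2^n} = −1` for a primitive `2^{n+1}`-th root of unity (any domain). -/
theorem pow_two_pow_eq_neg_one (hζ : IsPrimitiveRoot ζ (2 ^ (n + 1))) : ζ ^ 2 ^ n = -1 :=
  (hζ.pow (pow_pos two_pos _) (pow_succ 2 n)).eq_neg_one_of_two_right

/-- `ζ^{a + 2^n} = −ζ^a`: the index shift by `s = 2^n` is the sign. -/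
theorem pow_add_two_pow (hζ : IsPrimitiveRoot ζ (2 ^ (n + 1))) (a : ℕ) : ζ ^ (a + 2 ^ n) = -ζ ^ a := by
  rw [pow_add, pow_two_pow_eq_neg_one hζ, mul_neg_one]

/-- ★ **The `𝔾̂_m` SHIFT (strongest coordinate-free form of S3/R222 before transport by `ϑ`):**
`(ζ^a − 1) [+]_{𝔾̂_m} (−2) = ζ^{a + 2^n} − 1`, where `X [+]_{𝔾̂_m} Y = X + Y + XY` (tree
`ltF_one_add_X_pow_sub_one`) and `−2 = ζ^{2^n} − 1` is THE point of exact order `2` of `𝔾̂_m`.  Applying the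
additive comparison map `ϑ` (tree `evalPt₁_compSeriesC_addPt`) gives `w_{a+2^n} = w_a [+]_{f'} ϑ(−2)`. -/
theorem gm_add_neg_two (hζ : IsPrimitiveRoot ζ (2 ^ (n + 1))) (a : ℕ) :
    (ζ ^ a - 1) + (-2) + (ζ ^ a - 1) * (-2) = ζ ^ (a + 2 ^ n) - 1 := by
  rw [pow_add_two_pow hζ]; ring

omit [IsDomain M] in
/-- `−2` is `𝔾̂_m`-torsion killed by `[2]`: `[2]_{𝔾̂_m}(−2) = (−2) [+] (−2) = (1 + (−2))^2 − 1 = 0`. -/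
theorem gm_two_neg_two : ((-2 : M) + (-2) + (-2) * (-2)) = 0 := by ring

/-- `−2 = ζ^{2^n} − 1`: the order-`2` point is the level-`1` torsion point of the `ζ`-tower. -/
theorem neg_two_eq (hζ : IsPrimitiveRoot ζ (2 ^ (n + 1))) : (-2 : M) = ζ ^ 2 ^ n - 1 := by
  rw [pow_two_pow_eq_neg_one hζ]; ring

end RootShift

/-! ## §B′. R222 «SHIFT₂» IN TREE CURRENCY (`q = 2`, any `F`, any uniformiser `π`; PROVED):
`[π^n] ω_{n+1} = ω_1 = −π`, `[a + π^n] ω_{n+1} = [a] ω_{n+1} [+]_f (−π)`, and the GALOIS form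
`σ_{γ₀} · ω_{n+1} = ω_{n+1} [+]_f ω_1` in `E·K_π^{n+1}` for the unit `γ₀ = 1 + π^n` (`σ_{γ₀} = relGalOfUnit γ₀`
fixes `E`).  This is the strongest coordinate-free statement of S3/SHIFT₂; the `𝔾̂_m` identity of §B is its
`F = ℚ₂, π = 2` shadow. -/

section TreeShift

open ValuativeRel IsLocalRing Field
open Literature.NumberTheory.GaloisRepresentations Literature.NumberTheory.GaloisRepresentations.IsNonarchimedeanLocalField
  Literature.NumberTheory.GaloisRepresentations.LubinTate

variable {F : Type} [Field F] [ValuativeRel F] [TopologicalSpace F] [IsNonarchimedeanLocalField F]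

attribute [local instance] ltNormUniformSpace ltNormIsUniformAddGroup rk1 nF nE fintypeResidueField

variable {π : 𝒪[F]} (hπ : (valuation F).IsUniformizer (π : F))

/-- `[π^n · u] λ_{n+1} ≠ 0` for a unit `u` (the tree's primitivity argument). -/
theorem ltAct_pow_mul_unit_genPt_ne_zero (n : ℕ) (u : 𝒪[F]ˣ) :
    ltAct hπ n (π ^ n * u) (genPt hπ n) ≠ 0 := by
  intro h2
  have h3 : π ^ (n + 1) ∣ π ^ n * (u : 𝒪[F]) := pow_dvd_of_ltSMul_genPt_eq_zero hπ h2
  rw [pow_succ] at h3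
  have hπ0 : (π : 𝒪[F]) ^ n ≠ 0 := pow_ne_zero _ fun h => hπ.ne_zero (congrArg Subtype.val h)
  have h4 : π ∣ (u : 𝒪[F]) := (mul_dvd_mul_iff_left hπ0).mp h3
  have h5 : IsUnit π := isUnit_of_dvd_unit h4 u.isUnit
  have h6 : valuation F (π : F) = 1 :=
    (Valuation.Integers.isUnit_iff_valuation_eq_one (Valuation.integer.integers (valuation F))).mp h5
  exact hπ.val_lt_one.ne h6

/-- `[π^n] ω_{n+1} ≠ 0`. -/
theorem ltAct_pow_cohPt_ne_zero (n : ℕ) : ltAct hπ n (π ^ n) (cohPt hπ n) ≠ 0 := by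
  rw [cohPt_eq, ← ltAct_mul]
  exact ltAct_pow_mul_unit_genPt_ne_zero hπ n (cohUnit hπ n)

/-- `[π]([π^n] ω_{n+1}) = 0`. -/
theorem ltAct_pi_ltAct_pow_cohPt (n : ℕ) : ltAct hπ n π (ltAct hπ n (π ^ n) (cohPt hπ n)) = 0 := by
  rw [← ltAct_mul, ← pow_succ', cohPt_eq, ← ltAct_mul, ltAct_pow_mul_genPt]

/-- ★ **`[π^n] ω_{n+1} = ω_1 = −π`** (`q = 2`: the non-zero `π`-division point is `−π`, tree `coe_ltDivPt_one_two`). -/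
theorem ltAct_pow_cohPt_eq_ltDivPt (hq : residueFieldCard F = 2) (n : ℕ) :
    ltAct hπ n (π ^ n) (cohPt hπ n) = ltDivPt hπ n 1 := by
  rcases eq_zero_or_eq_neg_of_ltSMul_pi_eq_zero hπ (ltField π n) hq (ltAct_pi_ltAct_pow_cohPt hπ n) with h0 | hneg
  · exact absurd h0 (ltAct_pow_cohPt_ne_zero hπ n)
  · apply Subtype.ext; apply Subtype.ext
    rw [hneg, coe_ltDivPt_one_two hπ n hq, Subring.coe_neg, algebraMap_integer_apply]

/-- ★★ **SHIFT₂ in tree currency: `[a + π^n] ω_{n+1} = [a] ω_{n+1} [+]_f ω_1`** (`q = 2`, every `a ∈ 𝒪_F`). -/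
theorem ltAct_add_pow_cohPt (hq : residueFieldCard F = 2) (n : ℕ) (a : 𝒪[F]) :
    ltAct hπ n (a + π ^ n) (cohPt hπ n) =
      ltAdd (maxNilIdeal F (ltField π n)) (isLTRing_LTCoeff hπ) (isLTSeries_LTCoeff π)
        (ltAct hπ n a (cohPt hπ n)) (ltDivPt hπ n 1) := by
  rw [← ltAct_pow_cohPt_eq_ltDivPt hπ hq n]
  change ltSMul _ _ _ (LTCoeff.of F (a + π ^ n)) _ = _
  rw [map_add, add_ltSMul]

/-- **`[1 + π^n] ω_{n+1} = ω_{n+1} [+]_f ω_1`** (`q = 2`). -/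
theorem ltAct_one_add_pow_cohPt (hq : residueFieldCard F = 2) (n : ℕ) :
    ltAct hπ n (1 + π ^ n) (cohPt hπ n) =
      ltAdd (maxNilIdeal F (ltField π n)) (isLTRing_LTCoeff hπ) (isLTSeries_LTCoeff π)
        (cohPt hπ n) (ltDivPt hπ n 1) := by
  rw [ltAct_add_pow_cohPt hπ hq n 1, ltAct_one]

variable (E : IntermediateField F (AlgebraicClosure F)) [FiniteDimensional F E] [Normal F E]

/-- ★★ **GALOIS SHIFT₂ (`q = 2`): `σ_{γ₀} · ω_{n+1} = ω_{n+1} [+]_f ω_1` in `E·K_π^{n+1}`** for the unit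
`γ₀ = 1 + π^n` and `σ_{γ₀} = relGalOfUnit γ₀ ∈ Aut_F(E·K_π^{n+1})` (fixes `E`, `χ_π(σ_{γ₀}) ≡ γ₀`), `E ⊆ F^{nr}`.
With `localUntwistExists`/`relGal_prod` (§A) this is R217 + R222 of STUB-PLAN v7.3 in the tree's own currency:
the reflection `γ ↦ γ·γ₀` of the table `T(γ) = (𝒩 g)^{τ_γ}(ω)` is translation of the argument by `ω_1 = −π`. -/
theorem mapPt_relGalOfUnit_cohPt_eq_ltAdd (hq : residueFieldCard F = 2) (hE : E ≤ maxUnramified F) (n : ℕ)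
    (γ₀ : 𝒪[F]ˣ) (hγ₀ : (γ₀ : 𝒪[F]) = 1 + π ^ n) :
    mapPt (relGalOfUnit hπ E n hE γ₀) (inclPt (le_sup_right : ltField π n ≤ E ⊔ ltField π n) (cohPt hπ n)) =
      ltAdd (maxNilIdeal F (E ⊔ ltField π n : IntermediateField F (AlgebraicClosure F))) (isLTRing_LTCoeff hπ)
        (isLTSeries_LTCoeff π)
        (inclPt (le_sup_right : ltField π n ≤ E ⊔ ltField π n) (cohPt hπ n))
        (inclPt (le_sup_right : ltField π n ≤ E ⊔ ltField π n) (ltDivPt hπ n 1)) := by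
  have h1 : mapPt (relGalOfUnit hπ E n hE γ₀)
      (inclPt (le_sup_right : ltField π n ≤ E ⊔ ltField π n) (cohPt hπ n)) =
      inclPt (le_sup_right : ltField π n ≤ E ⊔ ltField π n) (ltAct hπ n (γ₀ : 𝒪[F]) (cohPt hπ n)) := by
    conv_lhs => rw [cohPt_eq, inclPt_ltAct_genPt]
    rw [mapPt_relGalOfUnit_relAct, ← inclPt_ltAct_genPt, ltAct_mul, ← cohPt_eq]
  rw [h1, hγ₀, ltAct_one_add_pow_cohPt hπ hq n, inclPt_ltAdd hπ]

include hπ in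
/-- `1 + π^n` IS a unit of `𝒪_F` for `n ≥ 1` (so the unit `γ₀` of the Galois shift exists). -/
theorem isUnit_one_add_pow {n : ℕ} (hn : n ≠ 0) : IsUnit (1 + π ^ n : 𝒪[F]) := by
  have hπnu : ¬ IsUnit (π : 𝒪[F]) := fun h5 =>
    hπ.val_lt_one.ne ((Valuation.Integers.isUnit_iff_valuation_eq_one
      (Valuation.integer.integers (valuation F))).mp h5)
  have hmem' : (-(π ^ n) : 𝒪[F]) ∈ nonunits 𝒪[F] := by
    rw [← IsLocalRing.mem_maximalIdeal]
    exact neg_mem (Ideal.pow_mem_of_mem _ ((IsLocalRing.mem_maximalIdeal _).mpr (mem_nonunits_iff.mpr hπnu)) n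
      (Nat.pos_of_ne_zero hn))
  have h := IsLocalRing.isUnit_one_sub_self_of_mem_nonunits _ hmem'
  rwa [sub_neg_eq_add] at h

end TreeShift

/-! ## §B″. R222 RECOGNISED IN THE TREE (family-1 tool «tree match», declared): the comparison-currency
SHIFT₂ of record (`compSeriesC_torsion_shift : evS z' ϑ = (evS z ϑ) [+]_{f'} ω₁'`, `1 + z' = −(1+z)`) IS the
tree's ★★ `coe_evalPt₁_compSeriesC_reflect` (`LubinTateComparisonReflectionTwo`: `ϑ(−2 − x) = −π' − ϑ(x)` on
ALL of `𝔪_ℂ` — the STRONGER statement, torsion or not) read through `evalPt₁_compSeriesC_eq_mk_evS`;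
`y [+]_{f'} (−π') = −π' − y` is the tree's `coe_tPt_ltDivPt_two`, `ω₁' = ϑ(−2) = −π'` its
`coe_evalPt₁_compSeriesC_negTwo`.  The `evS`-currency corollary, PROVED in three lines: -/

section ShiftOfRecord

open ValuativeRel IsLocalRing Field
open Literature.NumberTheory.GaloisRepresentations Literature.NumberTheory.GaloisRepresentations.IsNonarchimedeanLocalField
  Literature.NumberTheory.GaloisRepresentations.LubinTate Literature.NumberTheory.PAdicHodge

variable {F : Type} [Field F] [ValuativeRel F] [TopologicalSpace F] [IsNonarchimedeanLocalField F]

variable (hq : residueFieldCard F = 2) (h2 : (valuation F).IsUniformizer (((2 : ℕ) : 𝒪[F]) : F))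
  {σ₀ : absoluteGaloisGroup F} (hσ₀ : IsAbsArithFrob σ₀) (u : 𝒪[F]ˣ)
  {ε : (maxUnramifiedCompletion F)ˣ}
  (hε : maxUnramifiedCompletion.galAut F σ₀ (ε : maxUnramifiedCompletion F) =
    algebraMap 𝒪[F] (maxUnramifiedCompletion F) (u : 𝒪[F]) * (ε : maxUnramifiedCompletion F))

include hq in
/-- ★★ **R222 «SHIFT₂» OF RECORD in `evS` currency**: for `z, z' ∈ 𝔪_ℂ` with `1 + z' = −(1 + z)`,
`ϑ̄(z') = −π' − ϑ̄(z)` (`= ϑ̄(z) [+]_{f'} ω₁'`, `ω₁' = −π'`, `π' = 2u`), where `ϑ̄ = ϑ.map (𝒪̂_{F^nr} → 𝒪_{ℂ_F})`,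
`ϑ = compSeriesC h2 hσ₀ u hε`.  (`F` any local field with `|𝓀_F| = 2` and `2` a uniformiser, e.g. `ℚ₂`.) -/
theorem compSeriesC_torsion_shift (z z' : (maxNilIdealC F).toIdeal)
    (hz' : ((z' : CBall F) : CompletedAlgClosure F) = -2 - ((z : CBall F) : CompletedAlgClosure F)) :
    ((evS (maxNilIdealC F) z' ((compSeriesC h2 hσ₀ u hε).map (algebraMap (UnrCoeff F) (CBall F))) : CBall F) :
        CompletedAlgClosure F) =
      -algebraMap F (CompletedAlgClosure F) ((((u : 𝒪[F]) * ((2 : ℕ) : 𝒪[F]) : 𝒪[F]) : F)) -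
        ((evS (maxNilIdealC F) z ((compSeriesC h2 hσ₀ u hε).map (algebraMap (UnrCoeff F) (CBall F))) : CBall F) :
          CompletedAlgClosure F) := by
  have h := coe_evalPt₁_compSeriesC_reflect hq h2 hσ₀ u hε z z' hz'
  rw [evalPt₁_compSeriesC_eq_mk_evS hσ₀ u hε h2 z', evalPt₁_compSeriesC_eq_mk_evS hσ₀ u hε h2 z] at h
  exact h

include hq in
/-- The same as an involution statement on values: `ϑ̄(z') + ϑ̄(z) = −π'` (symmetric in `z ↔ z'`). -/
theorem compSeriesC_torsion_shift_add (z z' : (maxNilIdealC F).toIdeal)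
    (hz' : ((z' : CBall F) : CompletedAlgClosure F) = -2 - ((z : CBall F) : CompletedAlgClosure F)) :
    ((evS (maxNilIdealC F) z' ((compSeriesC h2 hσ₀ u hε).map (algebraMap (UnrCoeff F) (CBall F))) : CBall F) :
        CompletedAlgClosure F) +
      ((evS (maxNilIdealC F) z ((compSeriesC h2 hσ₀ u hε).map (algebraMap (UnrCoeff F) (CBall F))) : CBall F) :
          CompletedAlgClosure F) =
      -algebraMap F (CompletedAlgClosure F) ((((u : 𝒪[F]) * ((2 : ℕ) : 𝒪[F]) : 𝒪[F]) : F)) := by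
  rw [compSeriesC_torsion_shift hq h2 hσ₀ u hε z z' hz']; ring

end ShiftOfRecord

/-! ## §C. k3-g40 H1 (PROVED, any commutative ring): a series `≡ 1 (mod 2)` coefficientwise is `1 + 2y`. -/

section HalfSeries

open PowerSeries

variable {A : Type*} [CommRing A]

/-- ★ k3-g40 H1 `exists_half_of_sub_one_mem`: if every coefficient of `P − 1` lies in `(2)`, then
`P = 1 + C 2 * y` for some `y` (coefficientwise choice). -/
theorem exists_half_of_sub_one_mem (P : A⟦X⟧)
    (h : ∀ n, (coeff n P : A) - (if n = 0 then 1 else 0) ∈ Ideal.span {(2 : A)}) :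
    ∃ y : A⟦X⟧, P = 1 + C (2 : A) * y := by
  choose c hc using fun n => Ideal.mem_span_singleton'.mp (h n)
  refine ⟨mk c, PowerSeries.ext fun n => ?_⟩
  rw [map_add, coeff_C_mul, coeff_mk, coeff_one, mul_comm, hc n]
  split_ifs <;> ring

/-- The same with the constant term pinned: if moreover `P(0) = 1` then `y(0) = 0`. -/
theorem exists_half_of_sub_one_mem' (P : A⟦X⟧) (h0 : constantCoeff P = 1)
    (h : ∀ n, (coeff n P : A) - (if n = 0 then 1 else 0) ∈ Ideal.span {(2 : A)}) :
    ∃ y : A⟦X⟧, constantCoeff y = 0 ∧ P = 1 + C (2 : A) * y := by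
  choose c hc using fun n => Ideal.mem_span_singleton'.mp (h n)
  refine ⟨mk fun n => if n = 0 then 0 else c n, ?_, PowerSeries.ext fun n => ?_⟩
  · rw [← coeff_zero_eq_constantCoeff_apply, coeff_mk]
    exact if_pos rfl
  · simp only [map_add, coeff_C_mul, coeff_mk, coeff_one]
    split_ifs with hn
    · subst hn; rw [mul_zero, add_zero, coeff_zero_eq_constantCoeff_apply, h0]
    · rw [zero_add, mul_comm, hc n, if_neg hn, sub_zero]

end HalfSeries

/-! ## §C′. k3-g40 H3 `exists_Lam2_lift` (R219-INST₂ piece, PROVED) under the WEAKEST SUFFICIENT hypothesis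
`‖2‖ < 1` in `ℂ_F` (residue characteristic `2`; implied by the frame's `h2 : 2` a uniformiser via the tree's
`norm_two_lt_one_C`, and weaker than k3-g40's `hq : |𝓀_F| = 2`): the `Λ₂`-scalars `(−1)^d 2^d/(d+1)` lie in
`𝒪_{ℂ_F}`, so `Λ₂ = Σ_d (−1)^d 2^d/(d+1)·X^{d+1}` lifts to `(CBall F)⟦X⟧` — the integrality making EVAL₂ a tree `evS`. -/

section LamTwoLift

open ValuativeRel IsLocalRing Field
open Literature.NumberTheory.GaloisRepresentations Literature.NumberTheory.GaloisRepresentations.IsNonarchimedeanLocalField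
  Literature.NumberTheory.GaloisRepresentations.LubinTate Literature.NumberTheory.PAdicHodge

variable {F : Type} [Field F] [ValuativeRel F] [TopologicalSpace F] [IsNonarchimedeanLocalField F]
variable (h2C : ‖(2 : CompletedAlgClosure F)‖ < 1)

include h2C in
/-- `‖m‖ = 1` in `ℂ_F` for odd `m` (residue characteristic `2`). -/
theorem norm_natCast_eq_one_of_odd_C {m : ℕ} (hm : ¬ 2 ∣ m) : ‖(m : CompletedAlgClosure F)‖ = 1 := by
  obtain ⟨k, hk⟩ : ∃ k, m = 2 * k + 1 := ⟨m / 2, by omega⟩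
  have hlt : ‖((2 * k : ℕ) : CompletedAlgClosure F)‖ < 1 := by
    rw [Nat.cast_mul, norm_mul, Nat.cast_ofNat]
    calc ‖(2 : CompletedAlgClosure F)‖ * ‖(k : CompletedAlgClosure F)‖
        ≤ ‖(2 : CompletedAlgClosure F)‖ * 1 := by
          gcongr; exact IsUltrametricDist.norm_natCast_le_one _ _
      _ < 1 := by rw [mul_one]; exact h2C
  rw [hk, Nat.cast_succ, IsUltrametricDist.norm_add_eq_max_of_norm_ne_norm (by rw [norm_one]; exact hlt.ne),
    norm_one, max_eq_right hlt.le]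

include h2C in
/-- ★ `‖(−1)^d · 2^d/(d+1)‖ ≤ 1` in `ℂ_F` of residue characteristic `2` (`v₂(d+1) ≤ d`; if `2 = 0` in `ℂ_F`
— equal characteristic — the scalar is `1` for `d = 0` and `0` for `d ≥ 1`). -/
theorem norm_lamCoeff_le_one (d : ℕ) :
    ‖((-1 : CompletedAlgClosure F) ^ d * 2 ^ d / ((d : CompletedAlgClosure F) + 1))‖ ≤ 1 := by
  by_cases h20 : (2 : CompletedAlgClosure F) = 0
  · cases d with
    | zero => simp
    | succ k => rw [h20, zero_pow (Nat.succ_ne_zero k), mul_zero, zero_div, norm_zero]; exact zero_le_one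
  obtain ⟨a, m, hm, hdm⟩ := Nat.exists_eq_pow_mul_and_not_dvd (show d + 1 ≠ 0 by omega) 2 (by norm_num)
  have hm0 : m ≠ 0 := by rintro rfl; exact hm (dvd_zero 2)
  have ha : a ≤ d := by
    have h1 : 2 ^ a ≤ d + 1 := by rw [hdm]; exact Nat.le_mul_of_pos_right _ (Nat.pos_of_ne_zero hm0)
    have h2' : d + 1 ≤ 2 ^ d := Nat.lt_two_pow_self
    exact (Nat.pow_le_pow_iff_right (by norm_num)).mp (h1.trans h2')
  have hcast : ((d : CompletedAlgClosure F) + 1) = ((2 ^ a * m : ℕ) : CompletedAlgClosure F) := by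
    rw [← hdm]; push_cast; ring
  have hm1 := norm_natCast_eq_one_of_odd_C h2C hm
  have hne : ((d : CompletedAlgClosure F) + 1) ≠ 0 := by
    rw [hcast]; push_cast
    exact mul_ne_zero (pow_ne_zero _ h20) fun h0 => by
      rw [h0, norm_zero] at hm1; exact zero_ne_one hm1
  rw [norm_div, div_le_one (norm_pos_iff.mpr hne), hcast]
  push_cast
  rw [norm_mul, norm_mul, norm_pow, norm_pow, norm_pow, norm_neg, norm_one, one_pow, one_mul, hm1, mul_one]
  obtain ⟨k, rfl⟩ := Nat.exists_eq_add_of_le ha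
  rw [pow_add]
  exact mul_le_of_le_one_right (pow_nonneg (norm_nonneg _) _) (pow_le_one₀ (norm_nonneg _) h2C.le)

include h2C in
/-- The `Λ₂` scalar `(−1)^d 2^d/(d+1)` as an element of `𝒪_{ℂ_F}`. -/
def lamCoeffC (d : ℕ) : CBall F :=
  ⟨(-1 : CompletedAlgClosure F) ^ d * 2 ^ d / ((d : CompletedAlgClosure F) + 1),
    (mem_unitBall_iff _).mpr (norm_lamCoeff_le_one h2C d)⟩

theorem coe_lamCoeffC (d : ℕ) :
    ((lamCoeffC h2C d : CBall F) : CompletedAlgClosure F) =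
      (-1 : CompletedAlgClosure F) ^ d * 2 ^ d / ((d : CompletedAlgClosure F) + 1) :=
  rfl

include h2C in
/-- ★★ **k3-g40 H3 `exists_Lam2_lift` (PROVED, weakest hypothesis `‖2‖_{ℂ_F} < 1`):**
`Λ₂ = ½·log(1 + 2X) = Σ_{d ≥ 0} (−1)^d 2^d/(d+1)·X^{d+1}` has a lift `L ∈ 𝒪_{ℂ_F}⟦X⟧` with `L(0) = 0`
(so the tree's `evS`/`evS_subst` apply to `L ∘ y ∘ ϑ`). -/
theorem exists_Lam2_lift :
    ∃ L : PowerSeries (CBall F), PowerSeries.constantCoeff L = 0 ∧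
      ∀ d : ℕ, ((PowerSeries.coeff (d + 1) L : CBall F) : CompletedAlgClosure F) =
        (-1 : CompletedAlgClosure F) ^ d * 2 ^ d / ((d : CompletedAlgClosure F) + 1) := by
  refine ⟨PowerSeries.mk fun n => if n = 0 then 0 else lamCoeffC h2C (n - 1), ?_, fun d => ?_⟩
  · rw [← PowerSeries.coeff_zero_eq_constantCoeff_apply, PowerSeries.coeff_mk]
    exact if_pos rfl
  · rw [PowerSeries.coeff_mk, if_neg (Nat.succ_ne_zero d), Nat.add_sub_cancel, coe_lamCoeffC]

include h2C in
/-- ★ **H3 in the consumer's shape**: pushed along any ring hom `θ : ℂ_F → K` into a field (e.g. the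
`θ = (equivPadicComplex 2).toRingHom : ℂ_F → ℂ_[2]` of record), the lift `L` has `θ`-coefficients
`θ[X⁰]L = 0`, `θ[X^{d+1}]L = (−1)^d 2^d/(d+1)` — these are VERBATIM the hypotheses `hL0`, `hL` of k3-g40's
★★ `read_value_eq_tsum_lamTerm` (R221 «EVAL₂» of record), which are thereby discharged by name. -/
theorem exists_Lam2_lift_map {K : Type*} [Field K] (θ : CompletedAlgClosure F →+* K) :
    ∃ L : PowerSeries (CBall F), PowerSeries.constantCoeff L = 0 ∧
      θ ((PowerSeries.coeff 0 L : CBall F) : CompletedAlgClosure F) = 0 ∧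
      ∀ d : ℕ, θ ((PowerSeries.coeff (d + 1) L : CBall F) : CompletedAlgClosure F) =
        (-1) ^ d * (2 : K) ^ d / ((d : K) + 1) := by
  obtain ⟨L, hL0, hL⟩ := exists_Lam2_lift h2C
  refine ⟨L, hL0, ?_, fun d => ?_⟩
  · rw [PowerSeries.coeff_zero_eq_constantCoeff, hL0]; simp
  · rw [hL d, map_div₀, map_mul, map_pow, map_pow, map_neg, map_one, map_add, map_one, map_natCast, map_ofNat]

/-- The same in the FRAME OF RECORD (`2` a uniformiser of `F`, the hypothesis `h2` of the tree's `q = 2`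
comparison block `LubinTateComparisonReflectionTwo` and of R222's text): via the tree's `norm_two_lt_one_C`. -/
theorem exists_Lam2_lift_map_of_isUniformizer
    (h2 : (valuation F).IsUniformizer (((2 : ℕ) : 𝒪[F]) : F)) {K : Type*} [Field K]
    (θ : CompletedAlgClosure F →+* K) :
    ∃ L : PowerSeries (CBall F), PowerSeries.constantCoeff L = 0 ∧
      θ ((PowerSeries.coeff 0 L : CBall F) : CompletedAlgClosure F) = 0 ∧
      ∀ d : ℕ, θ ((PowerSeries.coeff (d + 1) L : CBall F) : CompletedAlgClosure F) =
        (-1) ^ d * (2 : K) ^ d / ((d : K) + 1) :=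
  exists_Lam2_lift_map (norm_two_lt_one_C h2) θ

end LamTwoLift

end Summit.BirchSwinnertonDyer.BirchSwinnertonDyer.Cruxes.SplitBadTwoLowerHalfOfFacts.WeakStrongK1G39

end
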